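import Summits.BirchSwinnertonDyer.BirchSwinnertonDyer.Theorems.GenusKolyvaginAtTwoPowDvdShaCardAtTwoRTSelmerLayerOneAtTwo
import Literature.NumberTheory.EllipticCurves.Rank1Residual.Typed.X5DescentSelmer
import Literature.NumberTheory.EllipticCurves.KolyvaginShaStructureIndexFormProofs
import Literature.NumberTheory.EllipticCurves.MordellWeilTheoremProofs
import HarnessLib

/-!
# Route `GenusKolyvaginAtTwo`, LINE 18 (L_T `PowDvdShaCardAtTwoRT`, stmt-BirchSwinnertonDyer-23659), stub R `stub_rankLeOneAtTwo` (v6.2) —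
# KOLYVAGIN'S FIRST DESCENT STEP AT `2` READ ON THE MORDELL–WEIL GROUP: on L_T's frame, modulo Q2 only,
# the `τ`-eigenpart of `E(K)` of sign `w(E)` (the side opposite to `y_K`) is TORSION

Seat `bsd-line-gk2-p5` g28 (cell `bsd-f1-sign2`), `--supports stmt-BirchSwinnertonDyer-23659` (helper; closes nothing).  THEOREMS ONLY
(no definition, no named fact, no `sorry`).  Sequel of `…RTSelmerLayerOneCore` (p743233) / `…RTSelmerLayerOneAtTwo` (the Selmer-level
layer-1 law `selmerLayerOneAtTwo_norm_onHabitat`: `2^(M₀+1) • (s + w • τ_* s) = 0` for every `s ∈ Sel_{2^M}(E/K)`, `M ≥ M₀ + 1`).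
BSD is NOT proved by any of this; neither is L_T, U_T, nor stub R.

WHY.  After LEAD rulings R5/R6 LINE 18's registered target shape is v6.2 = {R `stub_rankLeOneAtTwo` : «`rank E(K) ≤ 1`» on L_T's
frame} (gk2-p2 g20 / gk2-p4 g21).  Kolyvagin's rank argument at `2` = two exponent bounds on `Sel_{2^M}(E/K)` pushed to `E(K)` through the
Kummer injection `E(K)/2^M ↪ Sel_{2^M}` and Mordell–Weil.  THIS FILE pushes LAYER 1: for every `P ∈ E(K)` the Kummer classes `δ_M P` are Selmer,
`τ_* δ_M P = δ_M(τP)`, so the norm law gives `2^(M₀+1)(P + w τP) ∈ 2^M E(K)` for EVERY `M`; an element of the finitely generated group `E(K)`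
divisible by all powers of `2` is torsion.  Hence:
* `isOfFinAddOrder_add_rootNumber_smul_conj_onHabitat` — **`P + w • τP` has finite order for every `P ∈ E(K)`**;
* `isOfFinAddOrder_of_conj_eq_rootNumber_smul_onHabitat` — **every `P ∈ E(K)` with `τP = w • P` is torsion**.
What remains for R: LAYER 2 («`2^c (P − w τP) ∈ ℤ y_K + torsion`», gk2-p4 g21) and `2P = (P + wτP) + (P − wτP)`.

References: [GrossLMS1991] §5 Prop. 5.3, §10; [KolyvaginEulerSystems1990] Thm. A; [McCallumLMS1991] §5 Lemma 5.1 (p. 303), Thm. 5.4;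
[SilvermanAEC2009] Thm. VIII.6.7, VIII.§2.
-/

set_option autoImplicit false
set_option linter.dupNamespace false

noncomputable section

open scoped Classical Pointwise
open Function NumberField IsDedekindDomain WeierstrassCurve Field
open Literature.NumberTheory.EllipticCurves Literature.NumberTheory.GaloisRepresentations
open Literature.NumberTheory.EllipticCurves.Jetchev2008 Literature.NumberTheory.EllipticCurves.ModularForms
open Literature.NumberTheory.GaloisCohomology
open Literature.NumberTheory.GaloisRepresentations.DiscreteGaloisModule (localTatePairingZMod
  tateDual transverseSubgroup SelmerStructure)
open Literature.NumberTheory.Automorphic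
open Summit.BirchSwinnertonDyer.Rank1Residual
open Summit.BirchSwinnertonDyer.Rank1Residual.JET.SelmerVocabulary
open Summit.BirchSwinnertonDyer.Rank1Residual.JET.GlobalDuality
open Summit.BirchSwinnertonDyer.BirchSwinnertonDyer.Theses.GenusKolyvaginAtTwo (KolyvaginRelationAtTwo)
open Summit.BirchSwinnertonDyer.BirchSwinnertonDyer.Theorems.KolyvaginLowerBoundAtTwo

namespace Summit.BirchSwinnertonDyer.BirchSwinnertonDyer.Theorems.GenusExact.PlusDescent

/-! ## §5 Layer 1 ON THE MORDELL–WEIL GROUP: the `(+w)`-eigenpart of `E(K)` is torsion -/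

section MordellWeil

variable {K : Type} [Field K] [NumberField K] (W : WeierstrassCurve ℚ) [W.IsElliptic] [W.IsGloballyMinimal] [NeZero (W.conductorNorm ℤ)]

/-- **LAYER 1 ON `E(K)` (Kolyvagin's first descent step at `2`, Mordell–Weil reading), on L_T's frame modulo Q2 ONLY.**  With the binders
of `selmerLayerOneAtTwo_norm_onHabitat` (non-CM, odd Tamagawa product, an odd multiplicative prime, `Δ < 0`, the `2`-adic tower onto; `K`
imaginary quadratic, `d_K` odd `≠ −3`, Heegner, the two non-square clauses; a frame `(Dt, β, ι)` and a conductor-`1` datum `d₁` with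
`2^(M₀) ∥ P(1)`; `τ ≠ 1`): for EVERY `P ∈ E(K)`, **`P + w • τP` has finite order** (`w = W.rootNumber`, `τP = Affine.Point.map τ P`) — the
`τ`-eigenpart of `E(K)` of sign `w` (the side OPPOSITE to `y_K`) is torsion.  Proof: at each level `M ≥ M₀ + 1` the Kummer class `δ_M P` is Selmer
(`kummerMapTorsion_mem_selmerGroup`) with `τ_* δ_M P = δ_M (τP)` (`conjAct_kummerMapTorsion`), so the norm law gives `δ_M (2^(M₀+1)(P + w τP)) = 0`,
i.e. `2^(M₀+1)(P + w τP) ∈ 2^M E(K)` (`kummerMapTorsion_ker`); an element of the finitely generated `E(K)` (Mordell–Weil, `module_finite_point_holds`)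
divisible by every power of `2` is torsion (`isOfFinAddOrder_of_forall_exists_pow_smul_eq`).  This is the layer-1 half of «`rank E(K) ≤ 1`» (stub R
`stub_rankLeOneAtTwo` of LINE 18 v6.2); the other half is layer 2 (the `(−w)`-part modulo `ℤ y_K`).
[cite: GrossLMS1991, §5 Prop. 5.3, §10] [cite: KolyvaginEulerSystems1990, Thm. A] [cite: McCallumLMS1991, §5 Lemma 5.1 (p. 303), Thm. 5.4]
[cite: SilvermanAEC2009, Thm. VIII.6.7, VIII.§2] -/
theorem isOfFinAddOrder_add_rootNumber_smul_conj_onHabitat (hQ2 : KolyvaginRelationAtTwo)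
    (hCM : ¬ W.HasCM) (hTam : Odd W.tamagawaProduct)
    (v : HeightOneSpectrum (𝓞 ℚ)) (h2v : ((2 : ℕ) : 𝓞 ℚ) ∉ v.asIdeal)
    (hNv : ((W.conductorNorm ℤ : ℕ) : 𝓞 ℚ) ∈ v.asIdeal) (hmult : W.HasMultiplicativeReductionAt v) (hΔ : W.Δ < 0)
    (hK : IsImaginaryQuadratic K) (hodd : Odd (NumberField.discr K)) (hne3 : NumberField.discr K ≠ -3)
    (hHN : SatisfiesHeegnerHypothesis (W.conductorNorm ℤ) K)
    (hns : ¬ IsSquare ((NumberField.discr K : ℚ) * -|W.Δ|)) (hns₂ : ¬ IsSquare ((NumberField.discr K : ℚ) * (-(2 * |W.Δ|))))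
    (hρ : ∀ n : ℕ, 0 < n → W.HasSurjectiveModNGaloisRep ((2 : ℤ) ^ n))
    (Dt : ModularParametrizationData W (W.conductorNorm ℤ)) (β : ℤ) (ι : K →+* ℂ)
    (d₁ : KolyvaginHeegnerData Dt β ι 1) (M₀ : ℕ)
    (hdiv : ∃ Q : (W.baseChange (ringClassField K ι 1)).toAffine.Point, ((2 ^ M₀ : ℕ) : ℤ) • Q = d₁.derivedPoint)
    (hndiv : ¬ ∃ Q : (W.baseChange (ringClassField K ι 1)).toAffine.Point, ((2 ^ (M₀ + 1) : ℕ) : ℤ) • Q = d₁.derivedPoint)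
    (τ : K ≃ₐ[ℚ] K) (hτ1 : τ ≠ 1) (P : (W.baseChange K).toAffine.Point) :
    IsOfFinAddOrder (P + W.rootNumber • Affine.Point.map (W' := W) (τ : K →ₐ[ℚ] K) P) := by
  haveI : (W.baseChange K).IsElliptic := by rw [baseChange]; infer_instance
  haveI : Module.Finite ℤ (W.baseChange K).toAffine.Point := (W.baseChange K).module_finite_point_holds
  set x := P + W.rootNumber • Affine.Point.map (W' := W) (τ : K →ₐ[ℚ] K) P with hx_def
  -- `2^(M₀+1) • x ∈ 2^M E(K)` for every `M ≥ M₀ + 1`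
  have hdivM : ∀ M : ℕ, M₀ + 1 ≤ M →
      ∃ Q : (W.baseChange K).toAffine.Point, ((2 ^ M : ℕ) : ℤ) • Q = ((2 ^ (M₀ + 1) : ℕ) : ℤ) • x := by
    intro M hM
    have hn : ((2 ^ M : ℕ) : ℤ) ≠ 0 := by positivity
    have hgeom : ∀ R : geomPoints (W.baseChange K), ∃ Q : geomPoints (W.baseChange K), ((2 ^ M : ℕ) : ℤ) • Q = R :=
      (W.baseChange K).zsmul_geomPoints_surjective_of_charZero hn
    set κ := kummerMapTorsion (W.baseChange K) ((2 ^ M : ℕ) : ℤ) hgeom with hκ_def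
    have hs : κ P ∈ selmerGroup (W.baseChange K) ((2 ^ M : ℕ) : ℤ) :=
      (W.baseChange K).kummerMapTorsion_mem_selmerGroup _ hgeom P
    have hlaw := selmerLayerOneAtTwo_norm_onHabitat W hQ2 hCM hTam v h2v hNv hmult hΔ hK hodd hne3 hHN hns hns₂ hρ Dt β ι d₁ M₀
      hdiv hndiv τ hτ1 hM (κ P) hs
    rw [hκ_def, conjAct_kummerMapTorsion W τ _ hgeom P, ← map_zsmul, ← map_add, ← map_zsmul] at hlaw
    have hker : ((2 ^ (M₀ + 1) : ℕ) : ℤ) • x ∈ (kummerMapTorsion (W.baseChange K) ((2 ^ M : ℕ) : ℤ) hgeom).ker :=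
      (AddMonoidHom.mem_ker).mpr hlaw
    rw [kummerMapTorsion_ker] at hker
    obtain ⟨Q, hQ⟩ := hker
    exact ⟨Q, hQ⟩
  -- hence divisible by EVERY power of `2`, hence torsion (Mordell–Weil)
  have hall : ∀ M : ℕ, ∃ Q : (W.baseChange K).toAffine.Point, ((2 ^ M : ℕ) : ℤ) • Q = ((2 ^ (M₀ + 1) : ℕ) : ℤ) • x := by
    intro M
    obtain ⟨Q, hQ⟩ := hdivM (M + (M₀ + 1)) (by omega)
    refine ⟨((2 ^ (M₀ + 1) : ℕ) : ℤ) • Q, ?_⟩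
    rw [smul_smul, ← Nat.cast_mul, ← pow_add]
    exact hQ
  have htor : IsOfFinAddOrder (((2 ^ (M₀ + 1) : ℕ) : ℤ) • x) :=
    Literature.NumberTheory.EllipticCurves.isOfFinAddOrder_of_forall_exists_pow_smul_eq Nat.prime_two hall
  obtain ⟨m, hm0, hm⟩ := (isOfFinAddOrder_iff_zsmul_eq_zero).mp htor
  rw [smul_smul] at hm
  exact (isOfFinAddOrder_iff_zsmul_eq_zero).mpr ⟨m * ((2 ^ (M₀ + 1) : ℕ) : ℤ), mul_ne_zero hm0 (by positivity), hm⟩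

/-- **Corollary: a `(+w)`-eigenpoint of `E(K)` is torsion** — on L_T's frame modulo Q2, every `P ∈ E(K)` with `τP = w • P` has finite order
(`P + w • τP = 2 • P`).  For `w = 1` this is «`E(ℚ)` is torsion» read inside `E(K)`; for `w = −1`, «`E^(d_K)(ℚ)` is torsion».
[cite: GrossLMS1991, §10] [cite: KolyvaginEulerSystems1990, Thm. A] -/
theorem isOfFinAddOrder_of_conj_eq_rootNumber_smul_onHabitat (hQ2 : KolyvaginRelationAtTwo)
    (hCM : ¬ W.HasCM) (hTam : Odd W.tamagawaProduct)
    (v : HeightOneSpectrum (𝓞 ℚ)) (h2v : ((2 : ℕ) : 𝓞 ℚ) ∉ v.asIdeal)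
    (hNv : ((W.conductorNorm ℤ : ℕ) : 𝓞 ℚ) ∈ v.asIdeal) (hmult : W.HasMultiplicativeReductionAt v) (hΔ : W.Δ < 0)
    (hK : IsImaginaryQuadratic K) (hodd : Odd (NumberField.discr K)) (hne3 : NumberField.discr K ≠ -3)
    (hHN : SatisfiesHeegnerHypothesis (W.conductorNorm ℤ) K)
    (hns : ¬ IsSquare ((NumberField.discr K : ℚ) * -|W.Δ|)) (hns₂ : ¬ IsSquare ((NumberField.discr K : ℚ) * (-(2 * |W.Δ|))))
    (hρ : ∀ n : ℕ, 0 < n → W.HasSurjectiveModNGaloisRep ((2 : ℤ) ^ n))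
    (Dt : ModularParametrizationData W (W.conductorNorm ℤ)) (β : ℤ) (ι : K →+* ℂ)
    (d₁ : KolyvaginHeegnerData Dt β ι 1) (M₀ : ℕ)
    (hdiv : ∃ Q : (W.baseChange (ringClassField K ι 1)).toAffine.Point, ((2 ^ M₀ : ℕ) : ℤ) • Q = d₁.derivedPoint)
    (hndiv : ¬ ∃ Q : (W.baseChange (ringClassField K ι 1)).toAffine.Point, ((2 ^ (M₀ + 1) : ℕ) : ℤ) • Q = d₁.derivedPoint)
    (τ : K ≃ₐ[ℚ] K) (hτ1 : τ ≠ 1) (P : (W.baseChange K).toAffine.Point)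
    (hP : Affine.Point.map (W' := W) (τ : K →ₐ[ℚ] K) P = W.rootNumber • P) :
    IsOfFinAddOrder P := by
  have h := isOfFinAddOrder_add_rootNumber_smul_conj_onHabitat W hQ2 hCM hTam v h2v hNv hmult hΔ hK hodd hne3 hHN hns hns₂ hρ Dt β ι d₁
    M₀ hdiv hndiv τ hτ1 P
  have hw2 : W.rootNumber * W.rootNumber = 1 := by
    rcases W.rootNumber_eq_one_or with h1 | h1 <;> rw [h1] <;> norm_num
  rw [hP, smul_smul, hw2, one_smul, ← two_zsmul] at h
  obtain ⟨m, hm0, hm⟩ := (isOfFinAddOrder_iff_zsmul_eq_zero).mp h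
  rw [smul_smul] at hm
  exact (isOfFinAddOrder_iff_zsmul_eq_zero).mpr ⟨m * 2, mul_ne_zero hm0 two_ne_zero, hm⟩

end MordellWeil

end Summit.BirchSwinnertonDyer.BirchSwinnertonDyer.Theorems.GenusExact.PlusDescent

end
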